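/-
Copyright (c) 2026 the pub-hodgecm-mathlib formalisation cell (harness21).  Prover seat hodgecm-mathlib-F0P3a-p08 (g18): road «S3-tree» ROUTE (A) «SHALIKA» (LEAD F0P3a-plan
(g12), architect A-p16 (g30) ruling A-98 (1); END F0P3a-p03 (g15) contract v5 `stub_rankCM`), organ ‹RANK› — the CM frame; 2026-09-01.
-/
import Literature.NumberTheory.Rogawski1990.UnitaryVertexStabilizerSpanSelfDualStdCM    -- ★ p846189 F0P2-p06: `mem_cmLocalIntegralLevel_iff_mapGL_stdLattice_eq`; brings the good-reduction frame, `forall_mem_integer_iff_isIntMatrix`, `mapGL_stdLattice_eq_iff`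
import Literature.NumberTheory.Automorphic.UnitaryThreeUnipotentClassesUnramified       -- ★ p846484 (this seat) FILE 1: `isIntMatrix_inv_of_mem_unitaryGroupOfForm`; brings ★ FILE 0 `IntMatrixLevelConjugation`
import Literature.NumberTheory.Automorphic.SelfDualLatticeCountFrameTransportCM         -- ★ `valued_toPlace_uniformizer`, `toPlace_uniformizer_ne_zero`
import Literature.NumberTheory.Automorphic.UnramifiedOrbitSetAdelic                      -- ★ `coe_coe_localNonsplitEquiv_apply` (`rfl`)
import HarnessLib

/-!
# RANK, the CM frame: `ψ = T · e(·) · T⁻¹ : U(H′)(L⁺_v) → U(σ_w, J₀)(L_w)` at an unramified non-split place of good reduction — the hyperspecial level, the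
# level-2 congruence token, conjugacy classes and unipotency read through `ψ`

Topic `NumberTheory/Rogawski1990`; namespace `Literature.NumberTheory.Rogawski1990`.  THEOREMS ONLY (no definition, no instance, no notation, no named fact, no `sorry`); kernel
lane.  Cell `pub/hodgecm-mathlib` (D-0151), crux H413 = `stmt-HodgeConjecture-24833`; road «S3-tree» ROUTE (A) «SHALIKA» (architect A-p16 (g29∕g30) A-84 (2) ∕ A-87 (1) ∕
A-98 (1); END F0P3a-p03 (g15) contract v5 `stub_rankCM`), organ ‹RANK›: this file is the TRANSPORT between the carrier `G′_v = (cmDatum L 3 H′).Local v` of the letter and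
the matrix group `U(σ_w, J₀)(L_w) ≤ GL₃(L_w)` of ★ `UnitaryThreeUnipotentClassesUnramified`, along the composite `ψ(y) = T · e(y) · T⁻¹` of the one-place model ★
`e = localNonsplitEquiv` and the good-reduction frame ★ `H′_w = ᵗσ_w(T) J₀ T`, `T ∈ GL₃(𝒪_w)` (★ `exists_glInt_placeForm_eq_formCongr_antidiagonal_of_isUnramifiedIn`).  The
frame `T` is a HYPOTHESIS `(hT) (hTint)` of every statement (no definition is introduced); `ψ y` is spelled `T * ↑(e y) * T⁻¹`.

* §1 `ψ` is a multiplicative bijection onto `U(σ_w, J₀)`: `conj_localNonsplitEquiv_mem`, `exists_conj_localNonsplitEquiv_eq`, `conj_localNonsplitEquiv_mul ∕ _inv ∕ _one ∕ _injective`,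
  `continuous_conj_localNonsplitEquiv_apply`.
* §2 the hyperspecial level and the level-2 token through `ψ`: `isIntMatrix_frame`, **`mem_cmLocalIntegralLevel_iff_isIntMatrix_conj`** (`y ∈ K_std ↔ ψ y` integral — an integral
  element of `U(σ_w, J₀)` has integral inverse), **`forall_levelTwoToken_iff`** (END's `hg2` token `∀ a b, |(ϖ_v²)⁻¹((e u)_{ab} − 1_{ab})|_w ≤ 1` ↔ «entries of `ψ u − 1` are
  `≤ exp(−2)`»), `mem_cmLocalIntegralLevel_of_levelTwoToken`.
* §3 classes and unipotency through `ψ`: **`conjClasses_mk_eq_iff_exists_conj`** (`⟦y⟧ = ⟦y′⟧ ↔ ∃ k ∈ U(σ_w, J₀), k ψ(y) k⁻¹ = ψ(y′)`), `conj_localNonsplitEquiv_sub_one_pow_eq_zero`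
  (the letter's `(y.val.val − 1)^3 = 0` ⇒ `(ψ y − 1)^3 = 0`).
HONEST LABEL: HC_CM is proved only modulo the 2 remaining named inputs (hLiu418 24832, h413 24833) until rung 0 closes; nothing printed is asserted here; `stub_N6nsS3id` stays a
print row until the road's END lands.

## References
* [Rogawski1990] J. D. Rogawski, *Automorphic Representations of Unitary Groups in Three Variables*, Ann. of Math. Stud. 123 (1990), §4.9 p. 54, §8.1 p. 112, §14.2 p. 232.
* [Tits1979] J. Tits, *Reductive groups over local fields*, PSPM 33.1 (1979), §3.5, §3.8 (hyperspecial `U(J)(𝒪_v)` at unramified `v`).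
* [PlatonovRapinchuk1994] V. Platonov, A. Rapinchuk, *Algebraic Groups and Number Theory* (1994), §2.3, §5.1.
-/

set_option autoImplicit false

noncomputable section

open scoped Valued WithZero Matrix MatrixGroups
open Topology Set NumberField IsDedekindDomain Matrix

namespace Literature.NumberTheory.Rogawski1990

open Literature.NumberTheory.Automorphic Literature.NumberTheory.Automorphic.UnitaryGroup Literature.NumberTheory.GaloisRepresentations
open Literature.NumberTheory.Automorphic.UnitaryLatticeTree Literature.NumberTheory.Automorphic.HermitianLattice

variable (L : Type) [Field L] [NumberField L] [IsCMField L] (H' : Matrix (Fin 3) (Fin 3) L) (v : HeightOneSpectrum (𝓞 ↥(maximalRealSubfield L)))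
  (w : PlacesOver L v) (hw : IsCMField.complexConj L • w.1 = w.1)
  {T : GL (Fin 3) (w.1.adicCompletion L)}

/-! ## §1 `ψ = T·e(·)·T⁻¹` is a multiplicative bijection `U(H′)(L⁺_v) → U(σ_w, J₀)(L_w)` -/

section Frame

/-- The one-place model re-typed on the `cmDatum` carrier (so that `map_mul` runs in ONE rendering of the group law, as in ★ `span_isSelfDual_std`): an `E` with the same
underlying matrices as ★ `localNonsplitEquiv`. [cite: PlatonovRapinchuk1994, §5.1] -/
theorem exists_continuousMulEquiv_coe_eq_localNonsplitEquiv :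
    ∃ E : (cmDatum L 3 H').Local v ≃ₜ* ↥(unitaryGroupOfForm (galAdicCompletionMap (L := L) (IsCMField.complexConj L) hw) (placeForm H' w.1)),
      ∀ g, ((E g : ↥(unitaryGroupOfForm (galAdicCompletionMap (L := L) (IsCMField.complexConj L) hw) (placeForm H' w.1))) : GL (Fin 3) (w.1.adicCompletion L)) =
        ((localNonsplitEquiv (IsCMField.complexConj L) H' (IsCMField.complexConj_ne_one L) w hw g :
          ↥(unitaryGroupOfForm (galAdicCompletionMap (L := L) (IsCMField.complexConj L) hw) (placeForm H' w.1))) : GL (Fin 3) (w.1.adicCompletion L)) :=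
  ⟨localNonsplitEquiv (IsCMField.complexConj L) H' (IsCMField.complexConj_ne_one L) w hw, fun _ => rfl⟩

/-- **`ψ(y) ∈ U(σ_w, J₀)`**: with the frame `H′_w = ᵗσ_w(T)·J₀·T`, `T·e(y)·T⁻¹` preserves `J₀` (★ `conj_mem_unitaryGroupOfForm_iff`). [cite: PlatonovRapinchuk1994, §2.3] -/
theorem conj_localNonsplitEquiv_mem
    (hT : placeForm H' w.1 = formCongr (galAdicCompletionMap (L := L) (IsCMField.complexConj L) hw) T ((StdForm.antidiagonal 3).over (w.1.adicCompletion L)))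
    (y : (cmDatum L 3 H').Local v) :
    T * ((localNonsplitEquiv (IsCMField.complexConj L) H' (IsCMField.complexConj_ne_one L) w hw y :
        ↥(unitaryGroupOfForm (galAdicCompletionMap (L := L) (IsCMField.complexConj L) hw) (placeForm H' w.1))) : GL (Fin 3) (w.1.adicCompletion L)) * T⁻¹ ∈
      unitaryGroupOfForm (galAdicCompletionMap (L := L) (IsCMField.complexConj L) hw) ((StdForm.antidiagonal 3).over (w.1.adicCompletion L)) := by
  obtain ⟨E, hE⟩ := exists_continuousMulEquiv_coe_eq_localNonsplitEquiv L H' v w hw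
  rw [conj_mem_unitaryGroupOfForm_iff, ← hT, ← hE]
  exact (E y).2

/-- **`ψ` is onto `U(σ_w, J₀)`**: every `g ∈ U(σ_w, J₀)` is `T·e(y)·T⁻¹` (`y = e⁻¹(T⁻¹ g T)`). [cite: PlatonovRapinchuk1994, §2.3] -/
theorem exists_conj_localNonsplitEquiv_eq
    (hT : placeForm H' w.1 = formCongr (galAdicCompletionMap (L := L) (IsCMField.complexConj L) hw) T ((StdForm.antidiagonal 3).over (w.1.adicCompletion L)))
    {g : GL (Fin 3) (w.1.adicCompletion L)}
    (hg : g ∈ unitaryGroupOfForm (galAdicCompletionMap (L := L) (IsCMField.complexConj L) hw) ((StdForm.antidiagonal 3).over (w.1.adicCompletion L))) :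
    ∃ y : (cmDatum L 3 H').Local v,
      T * ((localNonsplitEquiv (IsCMField.complexConj L) H' (IsCMField.complexConj_ne_one L) w hw y :
        ↥(unitaryGroupOfForm (galAdicCompletionMap (L := L) (IsCMField.complexConj L) hw) (placeForm H' w.1))) : GL (Fin 3) (w.1.adicCompletion L)) * T⁻¹ = g := by
  have hg' : T⁻¹ * g * T ∈ unitaryGroupOfForm (galAdicCompletionMap (L := L) (IsCMField.complexConj L) hw) (placeForm H' w.1) := by
    rw [hT, ← conj_mem_unitaryGroupOfForm_iff, show T * (T⁻¹ * g * T) * T⁻¹ = g by group]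
    exact hg
  obtain ⟨E, hE⟩ := exists_continuousMulEquiv_coe_eq_localNonsplitEquiv L H' v w hw
  refine ⟨E.symm ⟨T⁻¹ * g * T, hg'⟩, ?_⟩
  rw [← hE, ContinuousMulEquiv.apply_symm_apply]
  change T * (T⁻¹ * g * T) * T⁻¹ = g
  group

/-- `ψ(y y′) = ψ(y) ψ(y′)`. [cite: PlatonovRapinchuk1994, §5.1] -/
theorem conj_localNonsplitEquiv_mul (y y' : (cmDatum L 3 H').Local v) :
    T * ((localNonsplitEquiv (IsCMField.complexConj L) H' (IsCMField.complexConj_ne_one L) w hw (y * y' : (cmDatum L 3 H').Local v) :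
        ↥(unitaryGroupOfForm (galAdicCompletionMap (L := L) (IsCMField.complexConj L) hw) (placeForm H' w.1))) : GL (Fin 3) (w.1.adicCompletion L)) * T⁻¹ =
      (T * ((localNonsplitEquiv (IsCMField.complexConj L) H' (IsCMField.complexConj_ne_one L) w hw y :
        ↥(unitaryGroupOfForm (galAdicCompletionMap (L := L) (IsCMField.complexConj L) hw) (placeForm H' w.1))) : GL (Fin 3) (w.1.adicCompletion L)) * T⁻¹) *
      (T * ((localNonsplitEquiv (IsCMField.complexConj L) H' (IsCMField.complexConj_ne_one L) w hw y' :
        ↥(unitaryGroupOfForm (galAdicCompletionMap (L := L) (IsCMField.complexConj L) hw) (placeForm H' w.1))) : GL (Fin 3) (w.1.adicCompletion L)) * T⁻¹) := by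
  obtain ⟨E, hE⟩ := exists_continuousMulEquiv_coe_eq_localNonsplitEquiv L H' v w hw
  rw [← hE, ← hE, ← hE, map_mul, Subgroup.coe_mul]
  group

/-- `ψ(y⁻¹) = ψ(y)⁻¹`. [cite: PlatonovRapinchuk1994, §5.1] -/
theorem conj_localNonsplitEquiv_inv (y : (cmDatum L 3 H').Local v) :
    T * ((localNonsplitEquiv (IsCMField.complexConj L) H' (IsCMField.complexConj_ne_one L) w hw (y⁻¹ : (cmDatum L 3 H').Local v) :
        ↥(unitaryGroupOfForm (galAdicCompletionMap (L := L) (IsCMField.complexConj L) hw) (placeForm H' w.1))) : GL (Fin 3) (w.1.adicCompletion L)) * T⁻¹ =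
      (T * ((localNonsplitEquiv (IsCMField.complexConj L) H' (IsCMField.complexConj_ne_one L) w hw y :
        ↥(unitaryGroupOfForm (galAdicCompletionMap (L := L) (IsCMField.complexConj L) hw) (placeForm H' w.1))) : GL (Fin 3) (w.1.adicCompletion L)) * T⁻¹)⁻¹ := by
  obtain ⟨E, hE⟩ := exists_continuousMulEquiv_coe_eq_localNonsplitEquiv L H' v w hw
  rw [← hE, ← hE, map_inv, Subgroup.coe_inv]
  group

/-- `ψ(1) = 1`. [cite: PlatonovRapinchuk1994, §5.1] -/
theorem conj_localNonsplitEquiv_one :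
    T * ((localNonsplitEquiv (IsCMField.complexConj L) H' (IsCMField.complexConj_ne_one L) w hw (1 : (cmDatum L 3 H').Local v) :
        ↥(unitaryGroupOfForm (galAdicCompletionMap (L := L) (IsCMField.complexConj L) hw) (placeForm H' w.1))) : GL (Fin 3) (w.1.adicCompletion L)) * T⁻¹ = 1 := by
  obtain ⟨E, hE⟩ := exists_continuousMulEquiv_coe_eq_localNonsplitEquiv L H' v w hw
  rw [← hE, map_one, Subgroup.coe_one, mul_one, mul_inv_cancel]

/-- `ψ` is injective. [cite: PlatonovRapinchuk1994, §5.1] -/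
theorem conj_localNonsplitEquiv_injective {y y' : (cmDatum L 3 H').Local v}
    (h : T * ((localNonsplitEquiv (IsCMField.complexConj L) H' (IsCMField.complexConj_ne_one L) w hw y :
        ↥(unitaryGroupOfForm (galAdicCompletionMap (L := L) (IsCMField.complexConj L) hw) (placeForm H' w.1))) : GL (Fin 3) (w.1.adicCompletion L)) * T⁻¹ =
      T * ((localNonsplitEquiv (IsCMField.complexConj L) H' (IsCMField.complexConj_ne_one L) w hw y' :
        ↥(unitaryGroupOfForm (galAdicCompletionMap (L := L) (IsCMField.complexConj L) hw) (placeForm H' w.1))) : GL (Fin 3) (w.1.adicCompletion L)) * T⁻¹) :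
    y = y' := by
  obtain ⟨E, hE⟩ := exists_continuousMulEquiv_coe_eq_localNonsplitEquiv L H' v w hw
  rw [← hE, ← hE] at h
  exact E.injective (Subtype.ext (mul_left_cancel (mul_right_cancel h)))

/-- The entries of `ψ(y)` depend continuously on `y`. [cite: PlatonovRapinchuk1994, §5.1] -/
theorem continuous_conj_localNonsplitEquiv_apply (a b : Fin 3) :
    Continuous fun y : (cmDatum L 3 H').Local v =>
      ((T * ((localNonsplitEquiv (IsCMField.complexConj L) H' (IsCMField.complexConj_ne_one L) w hw y :
        ↥(unitaryGroupOfForm (galAdicCompletionMap (L := L) (IsCMField.complexConj L) hw) (placeForm H' w.1))) : GL (Fin 3) (w.1.adicCompletion L)) * T⁻¹ :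
          GL (Fin 3) (w.1.adicCompletion L)) : Matrix (Fin 3) (Fin 3) (w.1.adicCompletion L)) a b := by
  obtain ⟨E, hE⟩ := exists_continuousMulEquiv_coe_eq_localNonsplitEquiv L H' v w hw
  have hψ : Continuous fun y : (cmDatum L 3 H').Local v =>
      (((T * ((E y : ↥(unitaryGroupOfForm (galAdicCompletionMap (L := L) (IsCMField.complexConj L) hw) (placeForm H' w.1))) : GL (Fin 3) (w.1.adicCompletion L)) * T⁻¹ :
        GL (Fin 3) (w.1.adicCompletion L)) : Matrix (Fin 3) (Fin 3) (w.1.adicCompletion L))) :=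
    Units.continuous_val.comp ((continuous_const.mul (continuous_subtype_val.comp E.continuous)).mul continuous_const)
  have h := hψ.matrix_elem a b
  simp only [hE] at h
  exact h

end Frame

/-! ## §2 The hyperspecial level and END's level-2 token through `ψ` -/

section Level

omit [IsCMField L] in
/-- The good-reduction frame `T ∈ GL₃(𝒪_w)` is integral with integral inverse (`ValuativeRel` ↔ `Valued.v` currency). [cite: Tits1979, §3.8] -/
theorem isIntMatrix_frame (hTint : T ∈ glInt 3 (w.1.adicCompletion L)) :
    IsIntMatrix (T : Matrix (Fin 3) (Fin 3) (w.1.adicCompletion L)) ∧ IsIntMatrix ((T⁻¹ : GL (Fin 3) (w.1.adicCompletion L)) : Matrix (Fin 3) (Fin 3) (w.1.adicCompletion L)) := by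
  have h := (mem_glInt_iff _).1 hTint
  rw [forall_mem_integer_iff_isIntMatrix L v w, forall_mem_integer_iff_isIntMatrix L v w] at h
  exact h

/-- **The hyperspecial level through `ψ`**: `y ∈ K_std = U(H′)(𝒪_v) ↔ ψ(y)` is INTEGRAL (its inverse is then integral too: ★ `isIntMatrix_inv_of_mem_unitaryGroupOfForm`,
`ψ(y) ∈ U(σ_w, J₀)`; and `e(y) = T⁻¹ ψ(y) T` with `T ∈ GL₃(𝒪_w)`, ★ `mem_cmLocalIntegralLevel_iff_mapGL_stdLattice_eq`, ★ `mapGL_stdLattice_eq_iff`). [cite: Tits1979, §3.8] -/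
theorem mem_cmLocalIntegralLevel_iff_isIntMatrix_conj
    (hT : placeForm H' w.1 = formCongr (galAdicCompletionMap (L := L) (IsCMField.complexConj L) hw) T ((StdForm.antidiagonal 3).over (w.1.adicCompletion L)))
    (hTint : T ∈ glInt 3 (w.1.adicCompletion L)) (y : (cmDatum L 3 H').Local v) :
    y ∈ cmLocalIntegralLevel L 3 H' v ↔
      IsIntMatrix ((T * ((localNonsplitEquiv (IsCMField.complexConj L) H' (IsCMField.complexConj_ne_one L) w hw y :
        ↥(unitaryGroupOfForm (galAdicCompletionMap (L := L) (IsCMField.complexConj L) hw) (placeForm H' w.1))) : GL (Fin 3) (w.1.adicCompletion L)) * T⁻¹ :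
          GL (Fin 3) (w.1.adicCompletion L)) : Matrix (Fin 3) (Fin 3) (w.1.adicCompletion L)) := by
  obtain ⟨hTi, hTii⟩ := isIntMatrix_frame L v w hTint
  rw [mem_cmLocalIntegralLevel_iff_mapGL_stdLattice_eq L H' v w hw, mapGL_stdLattice_eq_iff]
  constructor
  · rintro ⟨h1, -⟩
    rw [Units.val_mul, Units.val_mul]
    exact isIntMatrix_mul (isIntMatrix_mul hTi h1) hTii
  · intro h
    have hinv := isIntMatrix_inv_of_mem_unitaryGroupOfForm (galAdicCompletionMap (L := L) (IsCMField.complexConj L) hw)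
      (valued_galAdicCompletionMap (L := L) (IsCMField.complexConj L) hw) (conj_localNonsplitEquiv_mem L H' v w hw hT y) h
    have h1 := (isIntMatrix_conj_iff hTii (by rw [inv_inv]; exact hTi)
      (T * ((localNonsplitEquiv (IsCMField.complexConj L) H' (IsCMField.complexConj_ne_one L) w hw y :
        ↥(unitaryGroupOfForm (galAdicCompletionMap (L := L) (IsCMField.complexConj L) hw) (placeForm H' w.1))) : GL (Fin 3) (w.1.adicCompletion L)) * T⁻¹)).2 h
    have h2 := (isIntMatrix_conj_iff hTii (by rw [inv_inv]; exact hTi)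
      (T * ((localNonsplitEquiv (IsCMField.complexConj L) H' (IsCMField.complexConj_ne_one L) w hw y :
        ↥(unitaryGroupOfForm (galAdicCompletionMap (L := L) (IsCMField.complexConj L) hw) (placeForm H' w.1))) : GL (Fin 3) (w.1.adicCompletion L)) * T⁻¹)⁻¹).2 hinv
    rw [inv_inv, show T⁻¹ * (T * ((localNonsplitEquiv (IsCMField.complexConj L) H' (IsCMField.complexConj_ne_one L) w hw y :
        ↥(unitaryGroupOfForm (galAdicCompletionMap (L := L) (IsCMField.complexConj L) hw) (placeForm H' w.1))) : GL (Fin 3) (w.1.adicCompletion L)) * T⁻¹) * T =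
      (localNonsplitEquiv (IsCMField.complexConj L) H' (IsCMField.complexConj_ne_one L) w hw y : GL (Fin 3) (w.1.adicCompletion L)) by group] at h1
    rw [inv_inv, show T⁻¹ * (T * ((localNonsplitEquiv (IsCMField.complexConj L) H' (IsCMField.complexConj_ne_one L) w hw y :
        ↥(unitaryGroupOfForm (galAdicCompletionMap (L := L) (IsCMField.complexConj L) hw) (placeForm H' w.1))) : GL (Fin 3) (w.1.adicCompletion L)) * T⁻¹)⁻¹ * T =
      ((localNonsplitEquiv (IsCMField.complexConj L) H' (IsCMField.complexConj_ne_one L) w hw y : GL (Fin 3) (w.1.adicCompletion L)))⁻¹ by group] at h2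
    exact ⟨h1, h2⟩

/-- **END's level-2 token through `ψ`**: the `hg2` binder `∀ a b, |(ι_w(ϖ_v)²)⁻¹·((e u)_{ab} − 1_{ab})|_w ≤ 1` of the PARTIAL HEAD says exactly that every entry of `ψ(u) − 1`
has valuation `≤ exp(−2)` (`|ι_w(ϖ_v)| = exp(−1)` at an unramified place, ★ `valued_toPlace_uniformizer`; conjugation by `T ∈ GL₃(𝒪_w)` preserves the level, ★
`forall_v_conj_sub_one_apply_le_iff`). [cite: Tits1979, §3.5] [cite: Rogawski1990, §4.9 p. 54] -/
theorem forall_levelTwoToken_iff (hv : Algebra.IsUnramifiedIn (𝓞 L) v.asIdeal) (hTint : T ∈ glInt 3 (w.1.adicCompletion L)) (u : (cmDatum L 3 H').Local v) :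
    (∀ a b, Valued.v (((toPlace v w (HeckeCharacter.uniformizer ↥(maximalRealSubfield L) v : v.adicCompletion ↥(maximalRealSubfield L))) ^ 2)⁻¹ *
        ((((localNonsplitEquiv (IsCMField.complexConj L) H' (IsCMField.complexConj_ne_one L) w hw u :
            ↥(unitaryGroupOfForm (galAdicCompletionMap (L := L) (IsCMField.complexConj L) hw) (placeForm H' w.1))) : GL (Fin 3) (w.1.adicCompletion L)) :
              Matrix (Fin 3) (Fin 3) (w.1.adicCompletion L)) a b - (1 : Matrix (Fin 3) (Fin 3) (w.1.adicCompletion L)) a b)) ≤ 1) ↔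
      ∀ a b, Valued.v ((((T * ((localNonsplitEquiv (IsCMField.complexConj L) H' (IsCMField.complexConj_ne_one L) w hw u :
        ↥(unitaryGroupOfForm (galAdicCompletionMap (L := L) (IsCMField.complexConj L) hw) (placeForm H' w.1))) : GL (Fin 3) (w.1.adicCompletion L)) * T⁻¹ :
          GL (Fin 3) (w.1.adicCompletion L)) : Matrix (Fin 3) (Fin 3) (w.1.adicCompletion L)) - 1) a b) ≤ WithZero.exp (-2 : ℤ) := by
  obtain ⟨hTi, hTii⟩ := isIntMatrix_frame L v w hTint
  have hϖ := valued_toPlace_uniformizer L v w hv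
  have hϖ2 : ((toPlace v w (HeckeCharacter.uniformizer ↥(maximalRealSubfield L) v : v.adicCompletion ↥(maximalRealSubfield L))) ^ 2) ≠ 0 :=
    pow_ne_zero _ (toPlace_uniformizer_ne_zero L v w hv)
  have hv2 : Valued.v ((toPlace v w (HeckeCharacter.uniformizer ↥(maximalRealSubfield L) v : v.adicCompletion ↥(maximalRealSubfield L))) ^ 2) =
      WithZero.exp (-2 : ℤ) := by
    rw [map_pow, hϖ, ← WithZero.exp_nsmul]; norm_num
  rw [forall_v_conj_sub_one_apply_le_iff hTi hTii]
  refine forall_congr' fun a => forall_congr' fun b => ?_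
  rw [v_inv_mul_le_one_iff hϖ2, hv2, Matrix.sub_apply]

/-- An element satisfying END's level-2 token lies in the hyperspecial `K_std` (its `ψ` is `≡ 1 (mod 𝔪_w²)`, hence integral). [cite: Tits1979, §3.5] -/
theorem mem_cmLocalIntegralLevel_of_levelTwoToken
    (hT : placeForm H' w.1 = formCongr (galAdicCompletionMap (L := L) (IsCMField.complexConj L) hw) T ((StdForm.antidiagonal 3).over (w.1.adicCompletion L)))
    (hv : Algebra.IsUnramifiedIn (𝓞 L) v.asIdeal) (hTint : T ∈ glInt 3 (w.1.adicCompletion L)) {u : (cmDatum L 3 H').Local v}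
    (hu : ∀ a b, Valued.v (((toPlace v w (HeckeCharacter.uniformizer ↥(maximalRealSubfield L) v : v.adicCompletion ↥(maximalRealSubfield L))) ^ 2)⁻¹ *
        ((((localNonsplitEquiv (IsCMField.complexConj L) H' (IsCMField.complexConj_ne_one L) w hw u :
            ↥(unitaryGroupOfForm (galAdicCompletionMap (L := L) (IsCMField.complexConj L) hw) (placeForm H' w.1))) : GL (Fin 3) (w.1.adicCompletion L)) :
              Matrix (Fin 3) (Fin 3) (w.1.adicCompletion L)) a b - (1 : Matrix (Fin 3) (Fin 3) (w.1.adicCompletion L)) a b)) ≤ 1) :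
    u ∈ cmLocalIntegralLevel L 3 H' v := by
  rw [mem_cmLocalIntegralLevel_iff_isIntMatrix_conj L H' v w hw hT hTint]
  have h := (forall_levelTwoToken_iff L H' v w hw hv hTint u).1 hu
  have hle : WithZero.exp (-2 : ℤ) ≤ (1 : ℤᵐ⁰) := by rw [← WithZero.exp_zero, WithZero.exp_le_exp]; norm_num
  have h1 : IsIntMatrix (((T * ((localNonsplitEquiv (IsCMField.complexConj L) H' (IsCMField.complexConj_ne_one L) w hw u :
        ↥(unitaryGroupOfForm (galAdicCompletionMap (L := L) (IsCMField.complexConj L) hw) (placeForm H' w.1))) : GL (Fin 3) (w.1.adicCompletion L)) * T⁻¹ :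
          GL (Fin 3) (w.1.adicCompletion L)) : Matrix (Fin 3) (Fin 3) (w.1.adicCompletion L)) - 1) := fun a b => (h a b).trans hle
  have := isIntMatrix_add h1 isIntMatrix_one
  rwa [sub_add_cancel] at this

end Level

/-! ## §3 Conjugacy classes and unipotency through `ψ` -/

section Classes

/-- **CONJUGACY THROUGH `ψ`**: `⟦y⟧ = ⟦y′⟧` in `U(H′)(L⁺_v)` iff `k·ψ(y)·k⁻¹ = ψ(y′)` for some `k ∈ U(σ_w, J₀)(L_w)` (`ψ` is a multiplicative bijection onto `U(σ_w, J₀)`).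
[cite: Rogawski1990, §3.9 p. 32] -/
theorem conjClasses_mk_eq_iff_exists_conj
    (hT : placeForm H' w.1 = formCongr (galAdicCompletionMap (L := L) (IsCMField.complexConj L) hw) T ((StdForm.antidiagonal 3).over (w.1.adicCompletion L)))
    (y y' : (cmDatum L 3 H').Local v) :
    ConjClasses.mk y = ConjClasses.mk y' ↔
      ∃ k : GL (Fin 3) (w.1.adicCompletion L),
        k ∈ unitaryGroupOfForm (galAdicCompletionMap (L := L) (IsCMField.complexConj L) hw) ((StdForm.antidiagonal 3).over (w.1.adicCompletion L)) ∧
        k * (T * ((localNonsplitEquiv (IsCMField.complexConj L) H' (IsCMField.complexConj_ne_one L) w hw y :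
          ↥(unitaryGroupOfForm (galAdicCompletionMap (L := L) (IsCMField.complexConj L) hw) (placeForm H' w.1))) : GL (Fin 3) (w.1.adicCompletion L)) * T⁻¹) * k⁻¹ =
        T * ((localNonsplitEquiv (IsCMField.complexConj L) H' (IsCMField.complexConj_ne_one L) w hw y' :
          ↥(unitaryGroupOfForm (galAdicCompletionMap (L := L) (IsCMField.complexConj L) hw) (placeForm H' w.1))) : GL (Fin 3) (w.1.adicCompletion L)) * T⁻¹ := by
  rw [ConjClasses.mk_eq_mk_iff_isConj, isConj_iff]
  constructor
  · rintro ⟨c, hc⟩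
    refine ⟨T * ((localNonsplitEquiv (IsCMField.complexConj L) H' (IsCMField.complexConj_ne_one L) w hw c :
        ↥(unitaryGroupOfForm (galAdicCompletionMap (L := L) (IsCMField.complexConj L) hw) (placeForm H' w.1))) : GL (Fin 3) (w.1.adicCompletion L)) * T⁻¹,
      conj_localNonsplitEquiv_mem L H' v w hw hT c, ?_⟩
    rw [← hc, conj_localNonsplitEquiv_mul, conj_localNonsplitEquiv_mul, conj_localNonsplitEquiv_inv]
  · rintro ⟨k, hk, hconj⟩
    obtain ⟨c, hc⟩ := exists_conj_localNonsplitEquiv_eq L H' v w hw hT hk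
    refine ⟨c, conj_localNonsplitEquiv_injective L H' v w hw (T := T) ?_⟩
    rw [conj_localNonsplitEquiv_mul, conj_localNonsplitEquiv_mul, conj_localNonsplitEquiv_inv, hc, hconj]

/-- **UNIPOTENCY THROUGH `ψ`**: the letter's `((y.val : GL₃(L ⊗ L⁺_v)).val − 1)^3 = 0` (conjunct (i) of ★ `ShalikaGermExpansionNonsplit`) gives `(ψ(y) − 1)^3 = 0` — read the
`w`-component (★ `coe_coe_localNonsplitEquiv_apply`) and conjugate by `T` (★ `coe_conj_sub_one`, `Units.conj_pow`). [cite: Rogawski1990, §3.9 p. 32] -/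
theorem conj_localNonsplitEquiv_sub_one_pow_eq_zero {y : (cmDatum L 3 H').Local v} {n : ℕ}
    (hy : (((y.val : GL (Fin 3) (UnitaryGroup.LocalRing L v)).val - 1) ^ n) = 0) :
    ((((T * ((localNonsplitEquiv (IsCMField.complexConj L) H' (IsCMField.complexConj_ne_one L) w hw y :
        ↥(unitaryGroupOfForm (galAdicCompletionMap (L := L) (IsCMField.complexConj L) hw) (placeForm H' w.1))) : GL (Fin 3) (w.1.adicCompletion L)) * T⁻¹ :
          GL (Fin 3) (w.1.adicCompletion L)) : Matrix (Fin 3) (Fin 3) (w.1.adicCompletion L)) - 1) ^ n) = 0 := by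
  have hw' : ((((localNonsplitEquiv (IsCMField.complexConj L) H' (IsCMField.complexConj_ne_one L) w hw y :
      ↥(unitaryGroupOfForm (galAdicCompletionMap (L := L) (IsCMField.complexConj L) hw) (placeForm H' w.1))) : GL (Fin 3) (w.1.adicCompletion L)) :
        Matrix (Fin 3) (Fin 3) (w.1.adicCompletion L)) - 1) ^ n = 0 := by
    rw [coe_coe_localNonsplitEquiv_apply]
    have h' : (Pi.evalRingHom (fun w' : PlacesOver L v => w'.1.adicCompletion L) w).mapMatrix
        ((((y.val : GL (Fin 3) (UnitaryGroup.LocalRing L v)).val - 1) ^ n)) = 0 := by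
      rw [hy, map_zero]
    rw [map_pow, map_sub, map_one, RingHom.mapMatrix_apply] at h'
    exact h'
  rw [coe_conj_sub_one, Units.conj_pow, hw', Matrix.mul_zero, Matrix.zero_mul]

end Classes

end Literature.NumberTheory.Rogawski1990

end
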